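import Summits.QuantumFields.BalabanUV.Beta.FP.ConstrainedBiLaplacianSbTwoLevelSymbols
import Summits.QuantumFields.BalabanUV.Beta.FP.ConstrainedBiLaplacianSubcell

/-!
# `BalabanUV.Beta.FP.ConstrainedBiLaplacianSbTwoLevel` — road «FP», brick (g3) «(CONV-C)-Sb», THE TWO-LEG ONE-STEP LAW, FILE A (ALGEBRA):
# the uniform split `Gfib = [K=K′]·Dg − u_K ũ_{K′}·coef` of the regrouped fibre entries and the TRANSFERRED letters `DgT`, `coefT` (closed forms through
# the lineage's `T2`, `T2far`, `W1(0)`); the exact transfer identity itself is FILE A2 `…SbTwoLevelTransfer`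

NOT IN PRINT; OUR PROOF ATTEMPT (binder row G-an2-4 ∕ (CONV-C), prover part P3 = fibre∕strip «Woodbury» lineage, gen 29; CRUX TEAM (2), 2026-08-21).
HONEST DEPENDENCY (cell records, verbatim): «continuum YM on T⁴ ⇐ BetaPertH ∧ nine spine estimates (0/9 proved); BetaPertH ⇐ (D1) ∧ (D4) ∧ CAP+tail;
G-an2-4 gates asym, D1 and NE2/3/4.»  HONEST FRAMING (cell contract, verbatim): «discharging `BetaPertH` makes Bałaban's UV stability UNCONDITIONAL — a
real constructive-QFT result; it is NOT the continuum limit and NOT the Clay problem.»  ABSOLUTE RULE (cell charter, verbatim): «No internally-minted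
statement may enter as a cited fact. Every hypothesis is either kernel-proved in this package or a verbatim quotation of a PUBLISHED theorem with page
reference. The manuscript(s) under audit are NOT citable for their own disputed steps — they are the thing under adjudication; programme-internal
(2001/route/tribunal) claims are never citable.»  THIS MODULE is [folklore] algebra over FILE W of this programme (`GP`, `GM`, `sum_EF_Tsub`,
`sum_EFc_Tsub`, `F_zero_Kof`, `Fc_zero_Kof`, `GP_mul_GM`), gen 28's FILES 1∕2b∕6a (`ConstrainedBiLaplacianSubcell.avgM`, `…FibreEntries.{Gfib, coef, side}`,
`…ResponseTwoLevel.{T2, T2far}`) and gen 22's alias re-indexing (`SubAveragingFibreColumn.sum_Kof_eq`∕`Kof_injective`); it cites nothing as a hypothesis,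
has SIX bookkeeping `def`s (`nsd`, `Dg`, `nsdT`, `DgT`, `coefT`, `GT`), no `def … : Prop`, no `sorry`.

## The mechanism (census V69; journal INTENT «SB-TWO-LEG» 2026-08-21)

(§1) For EVERY alias pair the regrouped entries split UNIFORMLY as `Gfib N s K K′ = [K = K′]·Dg N s K − F N 0 K·Fc N 0 K′·coef N s K K′` with the
DIAGONAL LETTER `Dg K = nsd K + [K = 0]·(Spr + u_0 ũ_0)∕den` (`nsd K = [K ≠ 0]·ainv K`; `Dg_of_ne`, `Dg_zero`) and the rank-one coefficient in the
two-bilinear form `coef K K′ = (side K·side K′ + ((Δ^ξ)^s − 1)·nsd K·nsd K′)∕den` (`coef_eq`; `side = nsd + [K=0]`).  (§2) Summing the finer letters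
over the sub-aliases above a coarse alias with the sub-block weights gives the TRANSFERRED letters `nsdT k = Σ_m W1(Kof k m)·nsd_{nL}(Kof k m)`
(`= T2 k` for `k ≠ 0`, `= T2far` for `k = 0`), `DgT`, `coefT k k′ = Σ_{mm′} W1 W1′·coef_{nL}` with the SAME two-bilinear closed form one level up
(`coefT_eq`: `(sideT k·sideT k′ + ((Δ^{ξ∕L})^s − 1)·nsdT k·nsdT k′)∕den_{nL}`, `sideT k = nsdT k + [k=0]·W1(Kof 0 0)`), and `GT = [k=k′]·DgT −
F n 0 k·Fc n 0 k′·coefT`; **`M_eq_sum`**: `M n s τ σ p = n^{−d}·Σ_{kk′} EF·EFc·([k=k′]·Dg_n − F·Fc·coef_n)`.  The EXACT TRANSFER IDENTITY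
`L^d·avgM n L s τ σ = n^{−d}Σ EF·EFc·GT` is FILE A2 (`…SbTwoLevelTransfer`); FILE E estimates every letter difference by `C(d,L)∕n²`.

0∕4 row-D1 binders touched.  NOT (CONV-C), NEVER «G-an2-4 closed», NOT the ghost step law, NOT SDF, NOT D1, NOT BetaPertH, NOT continuum, NOT Clay.
Provenance: prover-b2b-balaban-gan24-p3-g29-0 (unit `b2b-balaban-gan24-p3`, gen 29), 2026-08-21; no existing file touched.
-/

noncomputable section

namespace Summit.QuantumFields.BalabanUV.Beta.FP.ConstrainedBiLaplacianSbTwoLevel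

open Complex Finset ComplexConjugate
open Literature.MathematicalPhysics.QuantumFieldTheory.Balaban1983to89
open Literature.MathematicalPhysics.QuantumFieldTheory.Balaban1983to89.B4Strip
open Literature.MathematicalPhysics.QuantumFieldTheory.Balaban1983to89.B4StripCauchy
open Literature.MathematicalPhysics.QuantumFieldTheory.Balaban1983to89.B4StripSums
open Summit.QuantumFields.BalabanUV.Beta.FP.ConstrainedBiLaplacianStrip
open Summit.QuantumFields.BalabanUV.Beta.FP.ConstrainedBiLaplacianFibre
open Summit.QuantumFields.BalabanUV.Beta.FP.ConstrainedBiLaplacianFibreEntries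
open Summit.QuantumFields.BalabanUV.Beta.FP.ConstrainedBiLaplacianKernel
open Summit.QuantumFields.BalabanUV.Beta.FP.ConstrainedBiLaplacianFibreIdentities
open Summit.QuantumFields.BalabanUV.Beta.FP.ConstrainedBiLaplacianSubcell (avgM)
open Summit.QuantumFields.BalabanUV.Beta.FP.ConstrainedBiLaplacianResponseTwoLevel (T2 T2far Kof_zero_eq_zero_iff)
open Summit.QuantumFields.BalabanUV.Beta.FP.ConstrainedBiLaplacianSbTwoLevelSymbols
open Summit.QuantumFields.BalabanUV.Beta.GAN24.SubAveragingCore (Kof Kof_val Kof_ne_zero)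
open Summit.QuantumFields.BalabanUV.Beta.GAN24.SubAveragingCoreEstimate (W1)
open Summit.QuantumFields.BalabanUV.Beta.GAN24.SubAveragingFibre (Kof_zero)
open Summit.QuantumFields.BalabanUV.Beta.GAN24.SubAveragingFibreColumn (sum_Kof_eq Kof_injective)
open Summit.QuantumFields.BalabanUV.Beta.GAN24.SubAveragingKernel (Tsub)
open scoped Real

variable {d : ℕ}

/-! ## §1 The uniform split of the regrouped entries -/

section Split

variable (N : ℕ) [NeZero N] (s : ℕ) (p : Fin d → ℂ)

/-- [folklore] THE OFF-ZERO DIAGONAL PART `nsd K = [K ≠ 0]·ainv K` (`= side K − [K = 0]`). -/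
def nsd (K : Fin d → Fin N) : ℂ := if K = fun _ => (0 : Fin N) then 0 else ainv N s K p

/-- [folklore] THE DIAGONAL LETTER `Dg K = nsd K + [K = 0]·(Spr + u_0 ũ_0)∕den`. -/
def Dg (K : Fin d → Fin N) : ℂ :=
  nsd N s p K + (if K = fun _ => (0 : Fin N) then
    (Spr N s p + F N (fun _ => 0) (fun _ => 0) p * Fc N (fun _ => 0) (fun _ => 0) p) / den N s p else 0)

/-- [folklore] `nsd 0 = 0`. -/
theorem nsd_zero : nsd N s p (fun _ => 0) = 0 := by unfold nsd; rw [if_pos rfl]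

/-- [folklore] `nsd K = ainv K` for `K ≠ 0`. -/
theorem nsd_of_ne {K : Fin d → Fin N} (hK : K ≠ fun _ => 0) : nsd N s p K = ainv N s K p := by unfold nsd; rw [if_neg hK]

/-- [folklore] `side K = nsd K + [K = 0]`. -/
theorem side_eq_nsd (K : Fin d → Fin N) : side N s K p = nsd N s p K + (if K = fun _ => (0 : Fin N) then 1 else 0) := by
  unfold side nsd; split_ifs <;> simp

/-- [folklore] `Dg K = ainv K` for `K ≠ 0`. -/
theorem Dg_of_ne {K : Fin d → Fin N} (hK : K ≠ fun _ => 0) : Dg N s p K = ainv N s K p := by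
  unfold Dg; rw [nsd_of_ne N s p hK, if_neg hK, add_zero]

/-- [folklore] `Dg 0 = (Spr + u_0 ũ_0)∕den`. -/
theorem Dg_zero : Dg N s p (fun _ => 0)
    = (Spr N s p + F N (fun _ => 0) (fun _ => 0) p * Fc N (fun _ => 0) (fun _ => 0) p) / den N s p := by
  unfold Dg; rw [nsd_zero, if_pos rfl, zero_add]

/-- [folklore] **THE RANK-ONE COEFFICIENT IN TWO-BILINEAR FORM**: `coef K K′ = (side K·side K′ + ((Δ^ξ)^s − 1)·nsd K·nsd K′)∕den` (all `K, K′`). -/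
theorem coef_eq (K K' : Fin d → Fin N) :
    coef N s K K' p = (side N s K p * side N s K' p + (DeltaXi N 0 p ^ s - 1) * nsd N s p K * nsd N s p K') / den N s p := by
  unfold coef nsd side
  by_cases hK : K = fun _ => 0
  · rw [if_neg (fun h => h.1 hK), if_pos hK, if_pos hK]; ring
  · by_cases hK' : K' = fun _ => 0
    · rw [if_neg (fun h => h.2 hK'), if_neg hK, if_pos hK', if_neg hK, if_pos hK']; ring
    · rw [if_pos ⟨hK, hK'⟩, if_neg hK, if_neg hK', if_neg hK, if_neg hK']; ring

/-- [folklore] **THE UNIFORM SPLIT** `Gfib K K′ = [K = K′]·Dg K − u_K ũ_{K′}·coef K K′` for EVERY alias pair. -/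
theorem Gfib_eq_Dg_sub (K K' : Fin d → Fin N) :
    Gfib N s K K' p = (if K = K' then Dg N s p K else 0) - F N (fun _ => 0) K p * Fc N (fun _ => 0) K' p * coef N s K K' p := by
  by_cases hKK : K = K'
  · subst hKK
    rw [if_pos rfl]
    by_cases hK : K = fun _ => 0
    · subst hK
      rw [Gfib_zero_zero, Dg_zero]
      unfold coef side
      rw [if_neg (fun h => h.1 rfl), if_pos rfl]
      field_simp
      ring
    · rw [Gfib_of_ne N s p hK hK, if_pos rfl, Dg_of_ne N s p hK]
      unfold coef side
      rw [if_pos ⟨hK, hK⟩, if_neg hK]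
  · rw [if_neg hKK]
    unfold Gfib
    rw [if_neg (fun h => hKK (h.1.trans h.2.symm)), if_neg hKK]

/-- [folklore] **THE LEVEL-`n` MULTIPLIER THROUGH THE SPLIT**: `M n s τ σ = n^{−d}Σ_{kk′} EF·EFc·([k=k′]·Dg − F·Fc·coef)`. -/
theorem M_eq_sum (τ σ : Fin d → Fin N) :
    M N s τ σ p = ((N : ℂ) ^ d)⁻¹ * ∑ k : Fin d → Fin N, ∑ k' : Fin d → Fin N, EF N τ k p * EFc N σ k' p *
      ((if k = k' then Dg N s p k else 0) - F N (fun _ => 0) k p * Fc N (fun _ => 0) k' p * coef N s k k' p) := by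
  unfold M
  congr 1
  exact Finset.sum_congr rfl fun k _ => Finset.sum_congr rfl fun k' _ => by rw [Gfib_eq_Dg_sub]

end Split

/-! ## §2 The transferred letters and their closed forms -/

section Transfer

variable (n L : ℕ) [NeZero n] [NeZero L] (s : ℕ) (p : Fin d → ℂ)

/-- [folklore] THE TRANSFERRED OFF-ZERO DIAGONAL PART `nsdT k = Σ_m W1(Kof k m)·nsd_{nL}(Kof k m)`. -/
def nsdT (k : Fin d → Fin n) : ℂ := ∑ m : Fin d → Fin L, W1 n L (Kof n L k m) p * nsd (n * L) s p (Kof n L k m)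

/-- [folklore] THE TRANSFERRED DIAGONAL LETTER `DgT k = Σ_m W1(Kof k m)·Dg_{nL}(Kof k m)`. -/
def DgT (k : Fin d → Fin n) : ℂ := ∑ m : Fin d → Fin L, W1 n L (Kof n L k m) p * Dg (n * L) s p (Kof n L k m)

/-- [folklore] THE TRANSFERRED RANK-ONE COEFFICIENT `coefT k k′ = Σ_{mm′} W1(Kof k m)·W1(Kof k′ m′)·coef_{nL}(Kof k m)(Kof k′ m′)`. -/
def coefT (k k' : Fin d → Fin n) : ℂ :=
  ∑ m : Fin d → Fin L, ∑ m' : Fin d → Fin L, W1 n L (Kof n L k m) p * W1 n L (Kof n L k' m') p * coef (n * L) s (Kof n L k m) (Kof n L k' m') p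

/-- [folklore] THE TRANSFERRED FIBRE ENTRIES `GT k k′ = [k=k′]·DgT k − u_k ũ_{k′}·coefT k k′` (the level-`n` block-averaging factors). -/
def GT (k k' : Fin d → Fin n) : ℂ :=
  (if k = k' then DgT n L s p k else 0) - F n (fun _ => 0) k p * Fc n (fun _ => 0) k' p * coefT n L s p k k'

/-- [folklore] `nsdT k = T2 k` for `k ≠ 0` (every finer alias above `k` is nonzero). -/
theorem nsdT_of_ne {k : Fin d → Fin n} (hk : k ≠ fun _ => 0) : nsdT n L s p k = T2 n L s p k := by
  unfold nsdT T2
  exact Finset.sum_congr rfl fun m _ => by rw [nsd_of_ne (n * L) s p (Kof_ne_zero n L hk m)]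

/-- [folklore] `nsdT 0 = T2far` (the sub-alias `m = 0` contributes nothing). -/
theorem nsdT_zero : nsdT n L s p (fun _ => 0) = T2far n L s p := by
  unfold nsdT T2far
  rw [← Finset.add_sum_erase Finset.univ _ (Finset.mem_univ (fun _ => (0 : Fin L))),
    (Kof_zero_eq_zero_iff n L (fun _ => 0)).mpr rfl, nsd_zero, mul_zero, zero_add]
  exact Finset.sum_congr rfl fun m hm => by
    rw [nsd_of_ne (n * L) s p (fun h => (Finset.ne_of_mem_erase hm) ((Kof_zero_eq_zero_iff n L m).mp h))]

/-- [folklore] `DgT k = T2 k` for `k ≠ 0`. -/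
theorem DgT_of_ne {k : Fin d → Fin n} (hk : k ≠ fun _ => 0) : DgT n L s p k = T2 n L s p k := by
  unfold DgT T2
  exact Finset.sum_congr rfl fun m _ => by rw [Dg_of_ne (n * L) s p (Kof_ne_zero n L hk m)]

/-- [folklore] `DgT 0 = W1(Kof 0 0)·Dg_{nL} 0 + T2far`. -/
theorem DgT_zero : DgT n L s p (fun _ => 0)
    = W1 n L (Kof n L (fun _ => 0) (fun _ => 0)) p * Dg (n * L) s p (fun _ => 0) + T2far n L s p := by
  unfold DgT T2far
  rw [← Finset.add_sum_erase Finset.univ _ (Finset.mem_univ (fun _ => (0 : Fin L))),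
    (Kof_zero_eq_zero_iff n L (fun _ => 0)).mpr rfl]
  congr 1
  exact Finset.sum_congr rfl fun m hm => by
    rw [Dg_of_ne (n * L) s p (fun h => (Finset.ne_of_mem_erase hm) ((Kof_zero_eq_zero_iff n L m).mp h))]

/-- [folklore] The sub-block weight of the zero sub-alias survives the zero test: `Σ_m W1(Kof k m)·[Kof k m = 0] = [k = 0]·W1(Kof 0 0)`. -/
theorem sum_W1_ite_zero (k : Fin d → Fin n) :
    ∑ m : Fin d → Fin L, W1 n L (Kof n L k m) p * (if Kof n L k m = fun _ => (0 : Fin (n * L)) then (1 : ℂ) else 0)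
      = if k = fun _ => (0 : Fin n) then W1 n L (Kof n L (fun _ => 0) (fun _ => 0)) p else 0 := by
  by_cases hk : k = fun _ => 0
  · subst hk
    rw [if_pos rfl]
    simp_rw [Kof_zero_eq_zero_iff n L]
    simp
  · rw [if_neg hk]
    exact Finset.sum_eq_zero fun m _ => by rw [if_neg (Kof_ne_zero n L hk m), mul_zero]

/-- [folklore] **THE TRANSFERRED SIDE FACTOR**: `Σ_m W1(Kof k m)·side_{nL}(Kof k m) = nsdT k + [k=0]·W1(Kof 0 0)`. -/
theorem sum_W1_side (k : Fin d → Fin n) :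
    ∑ m : Fin d → Fin L, W1 n L (Kof n L k m) p * side (n * L) s (Kof n L k m) p
      = nsdT n L s p k + (if k = fun _ => (0 : Fin n) then W1 n L (Kof n L (fun _ => 0) (fun _ => 0)) p else 0) := by
  simp_rw [side_eq_nsd, mul_add]
  rw [Finset.sum_add_distrib, sum_W1_ite_zero]
  rfl

/-- [folklore] **THE TRANSFERRED RANK-ONE COEFFICIENT IN TWO-BILINEAR FORM**:
`coefT k k′ = (sideT k·sideT k′ + ((Δ^{ξ∕L})^s − 1)·nsdT k·nsdT k′)∕den_{nL}`, `sideT k = nsdT k + [k=0]·W1(Kof 0 0)`. -/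
theorem coefT_eq (k k' : Fin d → Fin n) :
    coefT n L s p k k'
      = ((nsdT n L s p k + (if k = fun _ => (0 : Fin n) then W1 n L (Kof n L (fun _ => 0) (fun _ => 0)) p else 0))
          * (nsdT n L s p k' + (if k' = fun _ => (0 : Fin n) then W1 n L (Kof n L (fun _ => 0) (fun _ => 0)) p else 0))
        + (DeltaXi (n * L) 0 p ^ s - 1) * nsdT n L s p k * nsdT n L s p k') / den (n * L) s p := by
  have key : ∀ (f g : (Fin d → Fin L) → ℂ) (c : ℂ),
      c * (∑ m : Fin d → Fin L, f m) * (∑ m' : Fin d → Fin L, g m') = ∑ m : Fin d → Fin L, ∑ m' : Fin d → Fin L, c * f m * g m' := by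
    intro f g c
    rw [mul_assoc, Finset.sum_mul_sum, Finset.mul_sum]
    refine Finset.sum_congr rfl fun m _ => ?_
    rw [Finset.mul_sum]
    exact Finset.sum_congr rfl fun m' _ => by ring
  rw [← sum_W1_side, ← sum_W1_side]
  unfold coefT nsdT
  simp_rw [coef_eq]
  rw [← one_mul ((∑ m : Fin d → Fin L, W1 n L (Kof n L k m) p * side (n * L) s (Kof n L k m) p)
    * ∑ m : Fin d → Fin L, W1 n L (Kof n L k' m) p * side (n * L) s (Kof n L k' m) p), ← mul_assoc, key, key,
    ← Finset.sum_add_distrib, Finset.sum_div]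
  refine Finset.sum_congr rfl fun m _ => ?_
  rw [← Finset.sum_add_distrib, Finset.sum_div]
  refine Finset.sum_congr rfl fun m' _ => ?_
  ring

end Transfer

end Summit.QuantumFields.BalabanUV.Beta.FP.ConstrainedBiLaplacianSbTwoLevel

end
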